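import Summits.QuantumFields.BalabanUV.T4Continuum.Support.NE3TangentCovariantStructure
import HarnessLib

/-!
# T⁴ programme, node NE3 — THE FRAMES OF A GAUGE DIRECTION TELESCOPE: `δ_{gaugeDir W μ}(Γ) = μ(x) − Ad_{W(Γ)} μ(x + disp Γ)`, hence
# `frameLin L W (gaugeDir W μ) y = μ y − (transported block average of μ)` and the double-bar average of a gauge direction is the
# coarse gauge direction generated by the transported block average of its generator

NE3 formalisation swarm `b2b-balaban-t4-ne3-formalise-*`, LEAF PROVER 04 (gen 4), sub-row **E-MLw-w4-S** file 4 (SUPPLEMENT; INTENT in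
HOME/CLAIMS.log 2026-08-20) under the (w4) CORE of `t4/formal/NE3/LEAVES.md` row E-MLw-w4.  The structure theorem
`NE3TangentCovariantTower.dirIter_eq_QbarIter_add_gaugeDir` has the accumulated frames `framePotW` as generator; for the w4-P design
(low-mode removal by a smooth gauge direction, DESIGN MEMO `HOME/t4/b2b-balaban-t4-ne3-formalise-leaf-04/g4/E-MLw-w4-P-DESIGN-MEMO-leaf04-v1.md`
§2 P-e (e2)) one needs the frames OF A GAUGE DIRECTION explicitly.  They telescope — exactly, with no smallness:

* **`dhol_gaugeDir`** — `dhol W (gaugeDir W μ) x Γ = μ x − Ad_{hol W x Γ} (μ (x + disp Γ))` for every lattice word `Γ` (the derivative of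
  B7 (45)'s `u(Γ₋) W(Γ) u(Γ₊)⁻¹` along `u_t = e^{tμ}`, left-trivialised; induction on the word with `dhol_cons`∕`hol_cons`);
* **`frameLin_gaugeDir`** — `frameLin L W (gaugeDir W μ) y = μ y − Σ_r L^{−d}·Ad_{W(Γ_{y,y+r})} μ(y + r)` (`L ≥ 1`; `disp_treeWord`);
  `Fbar_gaugeDir` its coarse reading;
* **`Qbar_gaugeDir`** — in the small-field class of `NE3TangentCovariantStructure.cpush_gaugeDir`:
  `Qbar L W (gaugeDir W μ) = gaugeDir (cavg L W) (z ↦ Σ_r L^{−d}·Ad_{W(Γ_{Lz,Lz+r})} μ(Lz + r))` — THE LINEARISED DOUBLE-BAR AVERAGE OF A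
  GAUGE DIRECTION IS THE COARSE GAUGE DIRECTION GENERATED BY THE TRANSPORTED BLOCK AVERAGE OF ITS GENERATOR (B7 (47)∕(122) TYPE,
  linearised): `cpush_gaugeDir` (K1) minus the frame part of `cpush_eq_Qbar_add_gaugeDir` (K2).

HONEST: exact identities of the linearised averaging operation on OUR frame ([Balaban1985Averaging] (45)–(47) p. 24–25, (122) p. 36,
context only); nothing about minimisers, (P_W), (ML_w), T-E_w or NE3 is asserted; NE3 NOT proved; spine 0∕9; finite T⁴ rung (B)+1 — NOT
infinite volume, NOT mass gap, NOT BetaPertH, NOT Clay.  PLACEMENT: `Summits/QuantumFields/BalabanUV/`.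
-/

set_option autoImplicit false

open scoped BigOperators Matrix.Norms.L2Operator
open Finset

namespace Summit.QuantumFields.BalabanUV.T4Continuum.NE3GaugeDirFrames

open Literature.MathematicalPhysics.QuantumFieldTheory.Balaban1983to89
open B7Prop1Explicit B7Prop2Explicit
open T4AveragingDeficitWall (IsUnitaryCfg IsSkewDir SmallField Ad)
open T4AveragingDeficitWallBoundary (IsPeriodicCfg)
open T4AveragingDeficitNonAbelian (Ad_mul Ad_sub)
open AveragingDeficitTransport (dhol dstep dhol_nil dhol_cons dstep_true dstep_false)
open AveragingDeficitChartCalculus (cavg)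
open AveragingDeficitMultiLevelPrep (cpush)
open BlockAveragePushDirGauge (gaugeDir)
open BlockAveragePushDirSplit (frameLin)
open NE3TangentCovariantStructure (Qbar Fbar cpush_eq_Qbar_add_gaugeDir cpush_gaugeDir gaugeDir_add_fun)

noncomputable section

variable {d : ℕ} {n : Type*} [Fintype n] [DecidableEq n]

/-! ## §1 The linearised holonomy of a gauge direction telescopes -/

/-- `Ad_u (Ad_{u⁻¹} X) = X`. [folklore] -/
theorem Ad_Ad_inv (u : (Matrix n n ℂ)ˣ) (X : (Matrix n n ℂ)) : Ad u (Ad u⁻¹ X) = X := by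
  rw [← Ad_mul, mul_inv_cancel]; simp [Ad]

/-- **THE LINEARISED HOLONOMY OF A GAUGE DIRECTION TELESCOPES**: `dhol W (gaugeDir W μ) x Γ = μ x − Ad_{hol W x Γ} (μ (x + disp Γ))`
for every lattice word `Γ` — the derivative of `u(x) W(Γ) u(x + disp Γ)⁻¹` along `u_t = e^{tμ}`, left-trivialised.
[cite: Balaban1985Averaging, (45) p.24] -/
theorem dhol_gaugeDir (W : Site d → Fin d → (Matrix n n ℂ)ˣ) (mu : Site d → (Matrix n n ℂ)) :
    ∀ (w : List (Letter d)) (x : Site d), dhol W (gaugeDir W mu) x w = mu x - Ad (hol W x w) (mu (x + disp w))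
  | [], x => by simp [Ad]
  | (ν, true) :: w, x => by
      rw [dhol_cons, hol_cons, disp_cons, ← add_assoc, dhol_gaugeDir W mu w (x + Letter.vec (ν, true)), dstep_true,
        stepHol_true, Letter.vec_true]
      simp only [gaugeDir, Ad_mul, Ad_sub, Ad_Ad_inv]
      abel
  | (ν, false) :: w, x => by
      rw [dhol_cons, hol_cons, disp_cons, ← add_assoc, dhol_gaugeDir W mu w (x + Letter.vec (ν, false)), dstep_false,
        stepHol_false, Letter.vec_false]
      simp only [gaugeDir, Ad_mul, Ad_sub, ← sub_eq_add_neg, sub_add_cancel]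
      abel

/-! ## §2 The frame of a gauge direction; the double-bar average of a gauge direction -/

/-- **THE LINEARISED FRAME OF A GAUGE DIRECTION**: for `L ≥ 1`,
`frameLin L W (gaugeDir W μ) y = μ y − Σ_r L^{−d}·Ad_{W(Γ_{y,y+r})} μ(y + r)` (the generator at the corner minus the transported block
average of the generator). [cite: Balaban1985Averaging, (47) p.25] -/
theorem frameLin_gaugeDir {L : ℕ} (hL : 1 ≤ L) (W : Site d → Fin d → (Matrix n n ℂ)ˣ) (mu : Site d → (Matrix n n ℂ)) (y : Site d) :
    frameLin L W (gaugeDir W mu) y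
      = mu y - ∑ r : Fin d → Fin L, (((L : ℝ) ^ d)⁻¹) • Ad (hol W y (treeWord (boxVec L r))) (mu (y + boxVec L r)) := by
  unfold frameLin
  simp_rw [dhol_gaugeDir, disp_treeWord, smul_sub, Finset.sum_sub_distrib]
  congr 1
  have hL0 : ((L : ℝ) ^ d) ≠ 0 := pow_ne_zero _ (by exact_mod_cast (by omega : L ≠ 0))
  rw [Finset.sum_const, Finset.card_univ, Fintype.card_fun, Fintype.card_fin, Fintype.card_fin, ← Nat.cast_smul_eq_nsmul ℝ,
    smul_smul, Nat.cast_pow, mul_inv_cancel₀ hL0, one_smul]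

/-- Its coarse reading: `Fbar L W (gaugeDir W μ) z = μ (L•z) − Σ_r L^{−d}·Ad_{W(Γ_{Lz,Lz+r})} μ(L•z + r)`. [folklore] -/
theorem Fbar_gaugeDir {L : ℕ} (hL : 1 ≤ L) (W : Site d → Fin d → (Matrix n n ℂ)ˣ) (mu : Site d → (Matrix n n ℂ)) (z : Site d) :
    Fbar L W (gaugeDir W mu) z
      = mu ((L : ℤ) • z) - ∑ r : Fin d → Fin L, (((L : ℝ) ^ d)⁻¹) •
          Ad (hol W ((L : ℤ) • z) (treeWord (boxVec L r))) (mu ((L : ℤ) • z + boxVec L r)) :=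
  frameLin_gaugeDir hL W mu _

/-- **THE LINEARISED DOUBLE-BAR AVERAGE OF A GAUGE DIRECTION IS THE COARSE GAUGE DIRECTION GENERATED BY THE TRANSPORTED BLOCK AVERAGE OF
ITS GENERATOR**: in the small-field class of `cpush_gaugeDir` (unitary `(L·M)`-periodic `W`, `512(d+1)(d+4)L²a ≤ 1`, `SmallField W a`, skew
`(L·M)`-periodic `μ`), `Qbar L W (gaugeDir W μ) = gaugeDir (cavg L W) (z ↦ Σ_r L^{−d}·Ad_{W(Γ_{Lz,Lz+r})} μ(L•z + r))`.
[cite: Balaban1985Averaging, (122) p.36] -/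
theorem Qbar_gaugeDir [Nonempty n] {L M : ℕ} [NeZero M] [NeZero (L * M)] (hL : 1 ≤ L) {W : Site d → Fin d → (Matrix n n ℂ)ˣ}
    (hWu : IsUnitaryCfg W) (hWP : IsPeriodicCfg W ((L * M : ℕ) : ℤ)) {a : ℝ} (ha : 0 ≤ a)
    (hsmall : 512 * (d + 1) * (d + 4) * (L : ℝ) ^ 2 * a ≤ 1) (hWa : SmallField W a)
    {mu : Site d → (Matrix n n ℂ)} (hmu : ∀ x, mu x ∈ skewAdjoint (Matrix n n ℂ))
    (hmuP : ∀ (x : Site d) (i : Fin d), mu (x + ((L * M : ℕ) : ℤ) • e i) = mu x) :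
    Qbar L W (gaugeDir W mu) = gaugeDir (cavg L W) (fun z => ∑ r : Fin d → Fin L, (((L : ℝ) ^ d)⁻¹) •
        Ad (hol W ((L : ℤ) • z) (treeWord (boxVec L r))) (mu ((L : ℤ) • z + boxVec L r))) := by
  have h1 := cpush_gaugeDir (M := M) hL hWu hWP ha hsmall hWa hmu hmuP
  funext z κ
  have h2 := cpush_eq_Qbar_add_gaugeDir L W (gaugeDir W mu) z κ
  rw [h1] at h2
  -- `Fbar (gaugeDir μ) = μ∘L• − avg`, so `gaugeDir (cavg W) (μ∘L•) = gaugeDir (cavg W) (Fbar …) + gaugeDir (cavg W) avg`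
  have h3 : (fun y => mu ((L : ℤ) • y)) = fun y => Fbar L W (gaugeDir W mu) y + ∑ r : Fin d → Fin L, (((L : ℝ) ^ d)⁻¹) •
      Ad (hol W ((L : ℤ) • y) (treeWord (boxVec L r))) (mu ((L : ℤ) • y + boxVec L r)) := by
    funext y; rw [Fbar_gaugeDir hL, sub_add_cancel]
  rw [h3, gaugeDir_add_fun] at h2
  calc Qbar L W (gaugeDir W mu) z κ
      = (Qbar L W (gaugeDir W mu) z κ + gaugeDir (cavg L W) (Fbar L W (gaugeDir W mu)) z κ)
          - gaugeDir (cavg L W) (Fbar L W (gaugeDir W mu)) z κ := by rw [add_sub_cancel_right]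
    _ = _ := by rw [← h2, add_sub_cancel_left]

end

end Summit.QuantumFields.BalabanUV.T4Continuum.NE3GaugeDirFrames
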